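import Mathlib.Analysis.SpecialFunctions.Trigonometric.Bounds
import Mathlib.Analysis.Complex.Trigonometric
import Mathlib.Algebra.BigOperators.Module
import Mathlib.NumberTheory.Harmonic.Bounds
import Mathlib.Analysis.Normed.Group.InfiniteSum
import HarnessLib

/-!
# Abel summation against an additive character: `|Σ_{n<M} e(nθ)| ≤ 1/|sin πθ|`,
# `|Σ_n e(na/c) g(n)| ≤ V(g)/|sin(πa/c)|`, and `Σ_{0<a<c} 1/min(a, c−a) ≤ 2(1 + log c)`

Topic `Literature/NumberTheory/LFunctions` (cell landau-siegel / ls-inputs, input I2 =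
`bettin2017_theorem11_primeLevel`, line `hecke_afe_petersson`, stub S4 `stub_offDiagonal`).

Elementary harmonic-analysis lemmas used to bound the off-diagonal term of Bettin 2017, Thm. 1.1
(prime level, weight 2, `q = 1`, `α = 0`) by partial summation in `n` after opening the Kloosterman
sum `S(m,n;c) = Σ*_a e((ma + nā)/c)`:

* `norm_sum_range_exp_le` — the geometric sum `‖Σ_{n<M} e(nθ)‖ ≤ 1/|sin(πθ)|` (`sin πθ ≠ 0`);
* `abs_sin_pi_div_ge` — Jordan's inequality in the form `|sin(πa/c)| ≥ 2·min(a, c−a)/c` for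
  integers `0 < a < c`;
* `sum_inv_min_le` — `Σ_{a=1}^{c−1} 1/min(a, c−a) ≤ 2(1 + log c)`;
* `norm_tsum_mul_le_of_norm_sum_le` — Abel's inequality for an infinite sum: if all partial sums of
  `ε` have norm `≤ A`, `g → 0` and `Σ‖g(n+1) − g(n)‖ < ∞`, then `‖Σ_n ε(n) g(n)‖ ≤ A · Σ_n ‖g(n+1) − g(n)‖`.

All folklore (e.g. Iwaniec–Kowalski, *Analytic Number Theory*, §8.2 for the geometric sum and
partial summation); everything is proved, no definition, no named fact.
-/

noncomputable section

open scoped Real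
open Complex Finset Filter Topology

namespace Literature.NumberTheory.LFunctions.Bettin2017

/-! ### The geometric sum of an additive character -/

/-- **`‖Σ_{n<M} e(nθ)‖ ≤ 1/|sin(πθ)|`** whenever `sin(πθ) ≠ 0` (geometric series:
`Σ z^n = (z^M − 1)/(z − 1)`, `|z − 1| = 2|sin πθ|`; Iwaniec–Kowalski (8.6):
`Σ_{n ≤ N} e(αn) ≪ min(N, ‖α‖⁻¹)`). [cite: IwaniecKowalski2004, §8.2 (8.6)] -/
theorem norm_sum_range_exp_le {θ : ℝ} (hθ : Real.sin (π * θ) ≠ 0) (M : ℕ) :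
    ‖∑ n ∈ range M, Complex.exp (2 * π * I * θ * n)‖ ≤ 1 / |Real.sin (π * θ)| := by
  set z : ℂ := Complex.exp (2 * π * I * θ) with hz
  have hz1 : ‖z‖ = 1 := by
    rw [hz, show (2 * π * I * θ : ℂ) = I * ((2 * π * θ : ℝ) : ℂ) by push_cast; ring]
    exact Complex.norm_exp_I_mul_ofReal _
  have hzsub : ‖z - 1‖ = 2 * |Real.sin (π * θ)| := by
    rw [hz, show (2 * π * I * θ : ℂ) = I * ((2 * π * θ : ℝ) : ℂ) by push_cast; ring,
      Complex.norm_exp_I_mul_ofReal_sub_one, Real.norm_eq_abs, abs_mul, abs_two]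
    congr 2
    ring
  have hzne : z ≠ 1 := by
    intro h
    have : ‖z - 1‖ = 0 := by rw [h, sub_self, norm_zero]
    rw [hzsub] at this
    exact hθ (by simpa using this)
  have hterm : ∀ n : ℕ, Complex.exp (2 * π * I * θ * n) = z ^ n := by
    intro n
    rw [hz, ← Complex.exp_nat_mul]
    congr 1
    ring
  simp_rw [hterm]
  rw [geom_sum_eq hzne, norm_div, hzsub]
  have hnum : ‖z ^ M - 1‖ ≤ 2 := by
    calc ‖z ^ M - 1‖ ≤ ‖z ^ M‖ + ‖(1 : ℂ)‖ := norm_sub_le _ _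
      _ = 2 := by rw [norm_pow, hz1, one_pow, norm_one]; norm_num
  have hpos : 0 < |Real.sin (π * θ)| := abs_pos.mpr hθ
  rw [div_le_div_iff₀ (by positivity) hpos]
  have := mul_le_mul_of_nonneg_right hnum hpos.le
  linarith

/-- **Jordan's inequality for `sin(πa/c)`**: for integers `0 < a < c`,
`2·min(a, c − a)/c ≤ |sin(π a/c)|` (from `sin x ≥ (2/π) x` on `[0, π/2]` applied to `a/c` or to
`(c − a)/c`; DLMF 4.18.1). [cite: DLMF, 4.18.1 (Jordan's inequality)] -/
theorem abs_sin_pi_div_ge {a c : ℕ} (ha : 0 < a) (hac : a < c) :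
    2 * (min a (c - a) : ℕ) / (c : ℝ) ≤ |Real.sin (π * ((a : ℝ) / c))| := by
  have hc : (0 : ℝ) < c := by exact_mod_cast lt_trans ha hac
  -- the basic estimate for `b ≤ c/2`
  have key : ∀ b : ℕ, 2 * b ≤ c → 2 * (b : ℝ) / c ≤ Real.sin (π * ((b : ℝ) / c)) := by
    intro b hb
    have hb' : (2 : ℝ) * b ≤ c := by exact_mod_cast hb
    have hx0 : 0 ≤ π * ((b : ℝ) / c) := by positivity
    have hx1 : π * ((b : ℝ) / c) ≤ π / 2 := by
      rw [mul_div_assoc']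
      rw [div_le_div_iff₀ hc two_pos]
      nlinarith [Real.pi_pos]
    have h := Real.mul_le_sin hx0 hx1
    calc 2 * (b : ℝ) / c = 2 / π * (π * ((b : ℝ) / c)) := by field_simp
      _ ≤ Real.sin (π * ((b : ℝ) / c)) := h
  rcases le_or_gt (2 * a) c with h2 | h2
  · -- `a ≤ c/2`
    have hmin : (min a (c - a) : ℕ) ≤ a := min_le_left _ _
    calc 2 * ((min a (c - a) : ℕ) : ℝ) / c ≤ 2 * (a : ℝ) / c := by gcongr
      _ ≤ Real.sin (π * ((a : ℝ) / c)) := key a h2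
      _ ≤ |Real.sin (π * ((a : ℝ) / c))| := le_abs_self _
  · -- `a > c/2`: use `c - a`
    have hca : 2 * (c - a) ≤ c := by omega
    have hmin : (min a (c - a) : ℕ) ≤ c - a := min_le_right _ _
    have hsym : Real.sin (π * ((a : ℝ) / c)) = Real.sin (π * (((c - a : ℕ) : ℝ) / c)) := by
      rw [Nat.cast_sub hac.le, ← Real.sin_pi_sub]
      congr 1
      field_simp
    calc 2 * ((min a (c - a) : ℕ) : ℝ) / c ≤ 2 * ((c - a : ℕ) : ℝ) / c := by gcongr
      _ ≤ Real.sin (π * (((c - a : ℕ) : ℝ) / c)) := key (c - a) hca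
      _ = Real.sin (π * ((a : ℝ) / c)) := hsym.symm
      _ ≤ |Real.sin (π * ((a : ℝ) / c))| := le_abs_self _

/-- Consequently `1/|sin(π a/c)| ≤ c/(2·min(a, c − a))` for integers `0 < a < c` (Jordan's
inequality, DLMF 4.18.1; the form `‖a/c‖⁻¹` of Iwaniec–Kowalski (8.6)). [cite: DLMF, 4.18.1 (Jordan's inequality)] -/
theorem inv_abs_sin_pi_div_le {a c : ℕ} (ha : 0 < a) (hac : a < c) :
    1 / |Real.sin (π * ((a : ℝ) / c))| ≤ (c : ℝ) / (2 * (min a (c - a) : ℕ)) := by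
  have hc : (0 : ℝ) < c := by exact_mod_cast lt_trans ha hac
  have hmin : (0 : ℝ) < (min a (c - a) : ℕ) := by
    have : 0 < min a (c - a) := lt_min ha (by omega)
    exact_mod_cast this
  have h := abs_sin_pi_div_ge ha hac
  have hpos : 0 < 2 * ((min a (c - a) : ℕ) : ℝ) / c := by positivity
  have hsin : 0 < |Real.sin (π * ((a : ℝ) / c))| := lt_of_lt_of_le hpos h
  rw [div_le_div_iff₀ hsin (by positivity)]
  rw [div_le_iff₀ hc] at h
  linarith

/-! ### The harmonic sum over `1/min(a, c−a)` -/

/-- `Σ_{a=1}^{c−1} 1/min(a, c−a) ≤ 2(1 + log c)` (`1/min(a, c−a) ≤ 1/a + 1/(c−a)` and the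
harmonic bound `H_{c−1} ≤ 1 + log c`, Apostol Thm. 3.2(a)). [cite: Apostol1976, Thm. 3.2 (a)] -/
theorem sum_inv_min_le (c : ℕ) :
    ∑ a ∈ Ico 1 c, ((min a (c - a) : ℕ) : ℝ)⁻¹ ≤ 2 * (1 + Real.log c) := by
  rcases Nat.eq_zero_or_pos c with rfl | hc
  · simp
  -- termwise: `1/min(a, c−a) ≤ 1/a + 1/(c−a)`
  have hterm : ∀ a ∈ Ico 1 c,
      ((min a (c - a) : ℕ) : ℝ)⁻¹ ≤ ((a : ℕ) : ℝ)⁻¹ + ((c - a : ℕ) : ℝ)⁻¹ := by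
    intro a ha
    rw [mem_Ico] at ha
    have ha0 : (0 : ℝ) < a := by exact_mod_cast ha.1
    have hca0 : (0 : ℝ) < ((c - a : ℕ) : ℝ) := by exact_mod_cast (by omega : 0 < c - a)
    rcases min_choice a (c - a) with h | h <;> rw [h]
    · linarith [inv_pos.mpr hca0]
    · linarith [inv_pos.mpr ha0]
  -- both halves are the harmonic number `H_{c-1}`
  have hH : ∑ a ∈ Ico 1 c, ((a : ℕ) : ℝ)⁻¹ = (harmonic (c - 1) : ℝ) := by
    rw [harmonic_eq_sum_Icc, Rat.cast_sum]
    have hIco : Ico 1 c = Icc 1 (c - 1) := by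
      ext a; simp only [mem_Ico, mem_Icc]; omega
    rw [hIco]
    refine sum_congr rfl fun a _ ↦ ?_
    simp
  have hH' : ∑ a ∈ Ico 1 c, ((c - a : ℕ) : ℝ)⁻¹ = ∑ a ∈ Ico 1 c, ((a : ℕ) : ℝ)⁻¹ := by
    refine sum_nbij' (fun a ↦ c - a) (fun a ↦ c - a) ?_ ?_ ?_ ?_ ?_
    · intro a ha; rw [mem_Ico] at ha ⊢; omega
    · intro a ha; rw [mem_Ico] at ha ⊢; omega
    · intro a ha; rw [mem_Ico] at ha; omega
    · intro a ha; rw [mem_Ico] at ha; omega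
    · intro a ha; rfl
  have hlog' : Real.log ((c - 1 : ℕ) : ℝ) ≤ Real.log c := by
    rcases Nat.eq_zero_or_pos (c - 1) with h0 | hpos
    · rw [h0, Nat.cast_zero, Real.log_zero]; exact Real.log_natCast_nonneg c
    · exact Real.log_le_log (by exact_mod_cast hpos) (by exact_mod_cast Nat.sub_le c 1)
  have hlog : (harmonic (c - 1) : ℝ) ≤ 1 + Real.log c := by
    refine (harmonic_le_one_add_log (c - 1)).trans ?_
    linarith
  calc ∑ a ∈ Ico 1 c, ((min a (c - a) : ℕ) : ℝ)⁻¹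
      ≤ ∑ a ∈ Ico 1 c, (((a : ℕ) : ℝ)⁻¹ + ((c - a : ℕ) : ℝ)⁻¹) := sum_le_sum hterm
    _ = 2 * (harmonic (c - 1) : ℝ) := by rw [sum_add_distrib, hH', hH]; ring
    _ ≤ 2 * (1 + Real.log c) := by gcongr

/-! ### Abel's inequality for an infinite sum -/

/-- **Abel's inequality, finite form**: if every partial sum `Σ_{n<k} ε(n)` has norm `≤ A`, then
`‖Σ_{n<M} ε(n) g(n)‖ ≤ A (‖g(M−1)‖ + Σ_{n<M−1} ‖g(n+1) − g(n)‖)` (Abel's partial summation,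
Apostol Thm. 4.2 in discrete form). [cite: Apostol1976, Thm. 4.2 (Abel's identity)] -/
theorem norm_sum_mul_le_of_norm_sum_le {ε g : ℕ → ℂ} {A : ℝ}
    (hA : ∀ k, ‖∑ n ∈ range k, ε n‖ ≤ A) (M : ℕ) :
    ‖∑ n ∈ range M, ε n * g n‖ ≤
      A * (‖g (M - 1)‖ + ∑ n ∈ range (M - 1), ‖g (n + 1) - g n‖) := by
  have hA0 : 0 ≤ A := le_trans (norm_nonneg _) (hA 0)
  have hcomm : ∑ n ∈ range M, ε n * g n = ∑ n ∈ range M, g n • ε n := by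
    refine sum_congr rfl fun n _ ↦ ?_
    rw [smul_eq_mul, mul_comm]
  rw [hcomm, sum_range_by_parts]
  calc ‖g (M - 1) • ∑ i ∈ range M, ε i -
        ∑ i ∈ range (M - 1), (g (i + 1) - g i) • ∑ j ∈ range (i + 1), ε j‖
      ≤ ‖g (M - 1) • ∑ i ∈ range M, ε i‖ +
          ‖∑ i ∈ range (M - 1), (g (i + 1) - g i) • ∑ j ∈ range (i + 1), ε j‖ := norm_sub_le _ _
    _ ≤ ‖g (M - 1)‖ * A + ∑ i ∈ range (M - 1), ‖g (i + 1) - g i‖ * A := by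
        gcongr
        · rw [norm_smul]
          exact mul_le_mul_of_nonneg_left (hA M) (norm_nonneg _)
        · refine (norm_sum_le _ _).trans (sum_le_sum fun i _ ↦ ?_)
          rw [norm_smul]
          exact mul_le_mul_of_nonneg_left (hA (i + 1)) (norm_nonneg _)
    _ = A * (‖g (M - 1)‖ + ∑ n ∈ range (M - 1), ‖g (n + 1) - g n‖) := by
        rw [← sum_mul]; ring

/-- **Abel's inequality for an infinite sum**: if every partial sum of `ε` has norm `≤ A`, `g → 0`,
`Σ ‖g(n+1) − g(n)‖` converges and `Σ ε(n) g(n)` converges, then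
`‖Σ_n ε(n) g(n)‖ ≤ A · Σ_n ‖g(n+1) − g(n)‖` (Abel's partial summation, Apostol Thm. 4.2, in
the limit). [cite: Apostol1976, Thm. 4.2 (Abel's identity)] -/
theorem norm_tsum_mul_le_of_norm_sum_le {ε g : ℕ → ℂ} {A : ℝ}
    (hA : ∀ k, ‖∑ n ∈ range k, ε n‖ ≤ A) (hg : Tendsto g atTop (𝓝 0))
    (hV : Summable fun n ↦ ‖g (n + 1) - g n‖) (hs : Summable fun n ↦ ε n * g n) :
    ‖∑' n, ε n * g n‖ ≤ A * ∑' n, ‖g (n + 1) - g n‖ := by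
  have hA0 : 0 ≤ A := le_trans (norm_nonneg _) (hA 0)
  -- partial sums converge to the `tsum`s
  have hlim : Tendsto (fun M ↦ ‖∑ n ∈ range M, ε n * g n‖) atTop (𝓝 ‖∑' n, ε n * g n‖) :=
    (continuous_norm.tendsto _).comp hs.hasSum.tendsto_sum_nat
  have hVlim : Tendsto (fun M ↦ ∑ n ∈ range (M - 1), ‖g (n + 1) - g n‖) atTop
      (𝓝 (∑' n, ‖g (n + 1) - g n‖)) :=
    hV.hasSum.tendsto_sum_nat.comp (tendsto_sub_atTop_nat 1)
  have hglim : Tendsto (fun M ↦ ‖g (M - 1)‖) atTop (𝓝 0) := by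
    have h := (continuous_norm.tendsto (0 : ℂ)).comp (hg.comp (tendsto_sub_atTop_nat 1))
    rw [norm_zero] at h
    exact h
  have hR : Tendsto (fun M ↦ A * (‖g (M - 1)‖ + ∑ n ∈ range (M - 1), ‖g (n + 1) - g n‖)) atTop
      (𝓝 (A * (0 + ∑' n, ‖g (n + 1) - g n‖))) :=
    (hglim.add hVlim).const_mul A
  rw [zero_add] at hR
  exact le_of_tendsto_of_tendsto' hlim hR fun M ↦ norm_sum_mul_le_of_norm_sum_le hA M

end Literature.NumberTheory.LFunctions.Bettin2017

end
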